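import Mathlib
import Literature.NumberTheory.Transcendental.KZCubeRational
import Summits.KontsevichZagierPeriods.KontsevichZagierPeriods.Theorems.InverseLandauTateFamilyKernelStubEulerDivergence
import Summits.KontsevichZagierPeriods.KontsevichZagierPeriods.Theorems.InverseLandauTateFamilyKernelStubLinDensity

/-!
# Crux `TateFamilyKernel` (stmt-KontsevichZagierPeriods-9130), line `Sketch`:
# stub `stub_qhFaceMoments` (wave 13, Euler sector — telescoped face moments vanish)

Data: weights `a, b`, `T ∈ ℚ[z₀,z₁]` weighted-homogeneous of degree `d`, a finite set of weights
`W` and numerators `P_w` weighted-homogeneous of weight `w` (`w ∈ W`), `λ_w = w + a + b`.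
Hypothesis: all moments `∫_{(0,1)²} (Σ_w P_w)·T^k` vanish. Conclusion: for every `k`,

  `∫₀¹ Σ_w (∏_{v ∈ W∖w} (λ_v + dk)) · [a·(P_wT^k)(1,s) + b·(P_wT^k)(s,1)] ds = 0`.

Proof. For `R = P_wT^k` (weighted-homogeneous of degree `n = w + kd`,
`IsWeightedHomogeneous.mul/pow`) the weighted Euler identity `a z₀∂₀R + b z₁∂₁R = nR`
(`EulerDivergence.euler_aeval`) reads `(n + a + b)R = a(R + z₀∂₀R) + b(R + z₁∂₁R)
= ∂₀(a z₀R) + ∂₁(b z₁R)`. The divergence theorem on the unit square for these polynomial fields is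
Fubini on the open square (`LinDensity.setIntegral_pi_Ioo_fin_two`,
`LinDensity.setIntegral_Ioo_prod_Ioo_symm`, `MeasureTheory.setIntegral_prod`) followed by the
fundamental theorem of calculus in the inner variable
(`intervalIntegral.integral_eq_sub_of_hasDerivAt`; the `zᵢ = 0` endpoint carries the factor
`zᵢ = 0`): `∫_□ (R + z₀∂₀R) = ∫₀¹ R(1,s) ds`, `∫_□ (R + z₁∂₁R) = ∫₀¹ R(s,1) ds`
(`QhFaceMoments.setIntegral_sq_face_zero/one`). Hence
`(λ_w + dk)·∫_□ P_wT^k = a∫₀¹(P_wT^k)(1,s) + b∫₀¹(P_wT^k)(s,1)` (`QhFaceMoments.euler_moment`);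
multiplying by `∏_{v≠w}(λ_v + dk)` (`Finset.prod_erase_mul`) and summing over `w` turns the claim
into `(∏_v (λ_v + dk)) · ∫_□ (Σ_w P_w)T^k = 0`.

References: Kontsevich–Zagier 2001, §1.2 (an elementary real-analysis step of one test class of
the period conjecture). Mathlib plus the landed sibling files `…StubEulerDivergence` (Euler
identity, integrability of polynomials on the square), `…StubLinDensity` (Fubini on the open
square) and the calculus helper
`Literature.NumberTheory.Transcendental.KZ.hasDerivAt_aeval_comp_real`; no named fact, no new
definition. Helpers live in the sub-namespace `QhFaceMoments`.
-/

noncomputable section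

open MeasureTheory Set MvPolynomial
open Literature.NumberTheory.Transcendental
open Literature.ModelTheory.ExponentialFields (continuous_aeval_real)

namespace Summit.KontsevichZagierPeriods.InverseLandau.TateFamilyKernel.Descent

namespace QhFaceMoments

/-! ### One-variable calculus of the slices `x ↦ R(x, s)` and `y ↦ R(x, y)` -/

/-- Derivative of the horizontal slice: `d/dx R(x, s) = (∂₀R)(x, s)`. [folklore] -/
theorem hasDerivAt_aeval_left (R : MvPolynomial (Fin 2) ℚ) (s x : ℝ) :
    HasDerivAt (fun u : ℝ => aeval (![u, s] : Fin 2 → ℝ) R)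
      (aeval (![x, s] : Fin 2 → ℝ) (pderiv 0 R)) x := by
  have hγ : ∀ i : Fin 2, HasDerivAt (fun u : ℝ => (![u, s] : Fin 2 → ℝ) i)
      ((![1, 0] : Fin 2 → ℝ) i) x := by
    intro i
    fin_cases i
    · simpa using hasDerivAt_id' x
    · simpa using hasDerivAt_const x s
  have h := KZ.hasDerivAt_aeval_comp_real hγ R
  simpa [Fin.sum_univ_two] using h

/-- Derivative of the vertical slice: `d/dy R(x, y) = (∂₁R)(x, y)`. [folklore] -/
theorem hasDerivAt_aeval_right (R : MvPolynomial (Fin 2) ℚ) (x y : ℝ) :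
    HasDerivAt (fun u : ℝ => aeval (![x, u] : Fin 2 → ℝ) R)
      (aeval (![x, y] : Fin 2 → ℝ) (pderiv 1 R)) y := by
  have hγ : ∀ i : Fin 2, HasDerivAt (fun u : ℝ => (![x, u] : Fin 2 → ℝ) i)
      ((![0, 1] : Fin 2 → ℝ) i) y := by
    intro i
    fin_cases i
    · simpa using hasDerivAt_const y x
    · simpa using hasDerivAt_id' y
  have h := KZ.hasDerivAt_aeval_comp_real hγ R
  simpa [Fin.sum_univ_two] using h

/-- The slice value `R(f t, g t)` depends continuously on `t` when `f`, `g` do. [folklore] -/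
theorem continuous_aeval_vec {f g : ℝ → ℝ} (hf : Continuous f) (hg : Continuous g)
    (R : MvPolynomial (Fin 2) ℚ) : Continuous fun t => aeval (![f t, g t] : Fin 2 → ℝ) R :=
  (continuous_aeval_real R).comp (LinDensity.continuous_vec_two hf hg)

/-- **FTC along `z₀`.** `∫₀¹ [R + x∂₀R](x, s) dx = R(1, s)`: the integrand is `d/dx (x·R(x,s))`,
and the `x = 0` endpoint carries the factor `0`. [folklore] -/
theorem intervalIntegral_face_zero (R : MvPolynomial (Fin 2) ℚ) (s : ℝ) :
    ∫ x in (0 : ℝ)..1,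
        (aeval (![x, s] : Fin 2 → ℝ) R + x * aeval (![x, s] : Fin 2 → ℝ) (pderiv 0 R)) =
      aeval (![1, s] : Fin 2 → ℝ) R := by
  have hder : ∀ x ∈ uIcc (0 : ℝ) 1, HasDerivAt (fun u : ℝ => u * aeval (![u, s] : Fin 2 → ℝ) R)
      (aeval (![x, s] : Fin 2 → ℝ) R + x * aeval (![x, s] : Fin 2 → ℝ) (pderiv 0 R)) x :=
    fun x _ => by
      simpa only [one_mul] using (hasDerivAt_id' x).fun_mul (hasDerivAt_aeval_left R s x)
  have hcont : Continuous fun x : ℝ =>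
      aeval (![x, s] : Fin 2 → ℝ) R + x * aeval (![x, s] : Fin 2 → ℝ) (pderiv 0 R) :=
    (continuous_aeval_vec continuous_id continuous_const R).fun_add
      (continuous_id.fun_mul (continuous_aeval_vec continuous_id continuous_const (pderiv 0 R)))
  rw [intervalIntegral.integral_eq_sub_of_hasDerivAt hder (hcont.intervalIntegrable 0 1)]
  simp

/-- **FTC along `z₁`.** `∫₀¹ [R + y∂₁R](x, y) dy = R(x, 1)`. [folklore] -/
theorem intervalIntegral_face_one (R : MvPolynomial (Fin 2) ℚ) (x : ℝ) :
    ∫ y in (0 : ℝ)..1,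
        (aeval (![x, y] : Fin 2 → ℝ) R + y * aeval (![x, y] : Fin 2 → ℝ) (pderiv 1 R)) =
      aeval (![x, 1] : Fin 2 → ℝ) R := by
  have hder : ∀ y ∈ uIcc (0 : ℝ) 1, HasDerivAt (fun u : ℝ => u * aeval (![x, u] : Fin 2 → ℝ) R)
      (aeval (![x, y] : Fin 2 → ℝ) R + y * aeval (![x, y] : Fin 2 → ℝ) (pderiv 1 R)) y :=
    fun y _ => by
      simpa only [one_mul] using (hasDerivAt_id' y).fun_mul (hasDerivAt_aeval_right R x y)
  have hcont : Continuous fun y : ℝ =>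
      aeval (![x, y] : Fin 2 → ℝ) R + y * aeval (![x, y] : Fin 2 → ℝ) (pderiv 1 R) :=
    (continuous_aeval_vec continuous_const continuous_id R).fun_add
      (continuous_id.fun_mul (continuous_aeval_vec continuous_const continuous_id (pderiv 1 R)))
  rw [intervalIntegral.integral_eq_sub_of_hasDerivAt hder (hcont.intervalIntegrable 0 1)]
  simp

/-! ### The divergence theorem on the open unit square for the fields `z₀R·e₀`, `z₁R·e₁` -/

/-- **Flux through the face `z₀ = 1`.** `∫_{(0,1)²} (R + z₀∂₀R) = ∫₀¹ R(1, s) ds` (Fubini with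
`s = z₁` outside, then the FTC along `z₀`). [folklore] -/
theorem setIntegral_sq_face_zero (R : MvPolynomial (Fin 2) ℚ) :
    ∫ z in Set.pi Set.univ (fun _ : Fin 2 => Ioo (0 : ℝ) 1),
        (aeval z R + z 0 * aeval z (pderiv 0 R)) =
      ∫ s in (0 : ℝ)..1, aeval (![1, s] : Fin 2 → ℝ) R := by
  rw [LinDensity.setIntegral_pi_Ioo_fin_two]
  simp only [Matrix.cons_val_zero]
  have hG : Continuous fun p : ℝ × ℝ =>
      aeval (![p.1, p.2] : Fin 2 → ℝ) R + p.1 * aeval (![p.1, p.2] : Fin 2 → ℝ) (pderiv 0 R) :=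
    ((continuous_aeval_real R).comp
      (LinDensity.continuous_vec_two continuous_fst continuous_snd)).fun_add
      (continuous_fst.fun_mul ((continuous_aeval_real (pderiv 0 R)).comp
        (LinDensity.continuous_vec_two continuous_fst continuous_snd)))
  rw [LinDensity.setIntegral_Ioo_prod_Ioo_symm _ hG, intervalIntegral.integral_of_le zero_le_one,
    integral_Ioc_eq_integral_Ioo]
  refine setIntegral_congr_fun measurableSet_Ioo fun s _ => ?_
  rw [← intervalIntegral_face_zero R s, intervalIntegral.integral_of_le zero_le_one,
    integral_Ioc_eq_integral_Ioo]

/-- **Flux through the face `z₁ = 1`.** `∫_{(0,1)²} (R + z₁∂₁R) = ∫₀¹ R(s, 1) ds` (Fubini with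
`s = z₀` outside, then the FTC along `z₁`). [folklore] -/
theorem setIntegral_sq_face_one (R : MvPolynomial (Fin 2) ℚ) :
    ∫ z in Set.pi Set.univ (fun _ : Fin 2 => Ioo (0 : ℝ) 1),
        (aeval z R + z 1 * aeval z (pderiv 1 R)) =
      ∫ s in (0 : ℝ)..1, aeval (![s, 1] : Fin 2 → ℝ) R := by
  rw [LinDensity.setIntegral_pi_Ioo_fin_two]
  simp only [Matrix.cons_val_one, Matrix.cons_val_zero]
  have hG : Continuous fun p : ℝ × ℝ =>
      aeval (![p.1, p.2] : Fin 2 → ℝ) R + p.2 * aeval (![p.1, p.2] : Fin 2 → ℝ) (pderiv 1 R) :=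
    ((continuous_aeval_real R).comp
      (LinDensity.continuous_vec_two continuous_fst continuous_snd)).fun_add
      (continuous_snd.fun_mul ((continuous_aeval_real (pderiv 1 R)).comp
        (LinDensity.continuous_vec_two continuous_fst continuous_snd)))
  have hint : IntegrableOn (fun p : ℝ × ℝ =>
      aeval (![p.1, p.2] : Fin 2 → ℝ) R + p.2 * aeval (![p.1, p.2] : Fin 2 → ℝ) (pderiv 1 R))
      (Ioo (0 : ℝ) 1 ×ˢ Ioo (0 : ℝ) 1) ((volume : Measure ℝ).prod (volume : Measure ℝ)) := by
    rw [← Measure.volume_eq_prod]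
    exact (hG.continuousOn.integrableOn_compact (isCompact_Icc.prod isCompact_Icc)).mono_set
      (Set.prod_mono Ioo_subset_Icc_self Ioo_subset_Icc_self)
  rw [Measure.volume_eq_prod, setIntegral_prod _ hint, intervalIntegral.integral_of_le zero_le_one,
    integral_Ioc_eq_integral_Ioo]
  refine setIntegral_congr_fun measurableSet_Ioo fun x _ => ?_
  rw [← intervalIntegral_face_one R x, intervalIntegral.integral_of_le zero_le_one,
    integral_Ioc_eq_integral_Ioo]

/-- A `ℚ`-polynomial combination `R + zᵢ∂ᵢR` is integrable on the open square. [folklore] -/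
theorem integrableOn_face_integrand (R : MvPolynomial (Fin 2) ℚ) (i : Fin 2) :
    IntegrableOn (fun z : Fin 2 → ℝ => aeval z R + z i * aeval z (pderiv i R))
      (Set.pi Set.univ (fun _ : Fin 2 => Ioo (0 : ℝ) 1)) volume := by
  have hc : Continuous fun z : Fin 2 → ℝ => aeval z R + z i * aeval z (pderiv i R) :=
    (continuous_aeval_real R).fun_add
      ((continuous_apply i).fun_mul (continuous_aeval_real (pderiv i R)))
  exact hc.integrableOn_Icc.mono_set LinMoments.sq_subset_Icc

/-- **Euler moment identity.** For `R` weighted-homogeneous of degree `n` (weights `a, b`):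
`(n + a + b)·∫_{(0,1)²} R = a∫₀¹ R(1,s) ds + b∫₀¹ R(s,1) ds` — the weighted Euler identity
`(n + a + b)R = a(R + z₀∂₀R) + b(R + z₁∂₁R)` integrated over the square, plus the two flux
identities. [cite: KontsevichZagier2001, §1.2] -/
theorem euler_moment {a b n : ℕ} {R : MvPolynomial (Fin 2) ℚ}
    (hR : R.IsWeightedHomogeneous (![a, b] : Fin 2 → ℕ) n) :
    ((n : ℝ) + a + b) * ∫ z in Set.pi Set.univ (fun _ : Fin 2 => Ioo (0 : ℝ) 1), aeval z R =
      (a : ℝ) * (∫ s in (0 : ℝ)..1, aeval (![1, s] : Fin 2 → ℝ) R) +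
        (b : ℝ) * ∫ s in (0 : ℝ)..1, aeval (![s, 1] : Fin 2 → ℝ) R := by
  rw [← setIntegral_sq_face_zero, ← setIntegral_sq_face_one, ← integral_const_mul,
    ← integral_const_mul, ← integral_const_mul,
    ← integral_add ((integrableOn_face_integrand R 0).const_mul _)
      ((integrableOn_face_integrand R 1).const_mul _)]
  refine setIntegral_congr_fun LinMoments.measurableSet_sq fun z _ => ?_
  have e := EulerDivergence.euler_aeval hR z
  linear_combination -e

/-- The weighted degree of `P_w·T^k` is `w + kd`. [folklore] -/
theorem isWeightedHomogeneous_mul_pow {a b d w : ℕ} {T P : MvPolynomial (Fin 2) ℚ}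
    (hT : T.IsWeightedHomogeneous (![a, b] : Fin 2 → ℕ) d)
    (hP : P.IsWeightedHomogeneous (![a, b] : Fin 2 → ℕ) w) (k : ℕ) :
    (P * T ^ k).IsWeightedHomogeneous (![a, b] : Fin 2 → ℕ) (w + k * d) := by
  have h := hP.mul (hT.pow k)
  rwa [smul_eq_mul] at h

end QhFaceMoments

/-- STUB `stub_qhFaceMoments` (wave 13 — TELESCOPED FACE MOMENTS VANISH). For `T`
weighted-homogeneous (weights `a, b`, degree `d`), numerators `P_w` weighted-homogeneous of weight
`w ∈ W`, `λ_w = w + a + b`, and vanishing moments `∫_{(0,1)²} (Σ_w P_w)T^k = 0`: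
`∫₀¹ Σ_w (∏_{v∈W∖w}(λ_v + dk))·[a·(P_wT^k)(1,s) + b·(P_wT^k)(s,1)] ds = 0` — by the weighted Euler
identity `div(R·X) = (deg R + a + b)·R` for `R = P_wT^k`, `X = (az₀, bz₁)`, the divergence theorem
on the unit square (the `zᵢ = 0` faces carry no flux; `QhFaceMoments.euler_moment`) and
`(∏_{v≠w}(λ_v+dk))(λ_w+dk) = ∏_v(λ_v+dk)` (`Finset.prod_erase_mul`).
[cite: KontsevichZagier2001, §1.2] -/
theorem stub_qhFaceMoments (a b d : ℕ) (T : MvPolynomial (Fin 2) ℚ)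
    (hT : T.IsWeightedHomogeneous (![a, b] : Fin 2 → ℕ) d) (W : Finset ℕ) (Pw : ℕ → MvPolynomial (Fin 2) ℚ)
    (hPw : ∀ w ∈ W, (Pw w).IsWeightedHomogeneous (![a, b] : Fin 2 → ℕ) w)
    (hmom : ∀ k : ℕ, ∫ z in Set.pi Set.univ (fun _ : Fin 2 => Ioo (0 : ℝ) 1),
      aeval z ((∑ w ∈ W, Pw w) * T ^ k) = 0) :
    ∀ k : ℕ, ∫ s in (0 : ℝ)..1, ∑ w ∈ W,
      (∏ v ∈ W.erase w, (((v + a + b : ℕ) : ℝ) + (d : ℝ) * k)) *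
        ((a : ℝ) * aeval (![1, s] : Fin 2 → ℝ) (Pw w * T ^ k) +
          (b : ℝ) * aeval (![s, 1] : Fin 2 → ℝ) (Pw w * T ^ k)) = 0 := by
  intro k
  -- continuity of the two face slices and of the summands
  have hc1 : ∀ w, Continuous fun s : ℝ => aeval (![1, s] : Fin 2 → ℝ) (Pw w * T ^ k) := fun w =>
    QhFaceMoments.continuous_aeval_vec continuous_const continuous_id _
  have hc2 : ∀ w, Continuous fun s : ℝ => aeval (![s, 1] : Fin 2 → ℝ) (Pw w * T ^ k) := fun w =>
    QhFaceMoments.continuous_aeval_vec continuous_id continuous_const _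
  have hcs : ∀ w, Continuous fun s : ℝ =>
      (∏ v ∈ W.erase w, (((v + a + b : ℕ) : ℝ) + (d : ℝ) * k)) *
        ((a : ℝ) * aeval (![1, s] : Fin 2 → ℝ) (Pw w * T ^ k) +
          (b : ℝ) * aeval (![s, 1] : Fin 2 → ℝ) (Pw w * T ^ k)) := fun w =>
    (((hc1 w).const_mul _).fun_add ((hc2 w).const_mul _)).const_mul _
  -- per weight: the Euler moment identity, multiplied by the telescoping coefficient
  have hw : ∀ w ∈ W, ∫ s in (0 : ℝ)..1,
      (∏ v ∈ W.erase w, (((v + a + b : ℕ) : ℝ) + (d : ℝ) * k)) *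
        ((a : ℝ) * aeval (![1, s] : Fin 2 → ℝ) (Pw w * T ^ k) +
          (b : ℝ) * aeval (![s, 1] : Fin 2 → ℝ) (Pw w * T ^ k)) =
      (∏ v ∈ W, (((v + a + b : ℕ) : ℝ) + (d : ℝ) * k)) *
        ∫ z in Set.pi Set.univ (fun _ : Fin 2 => Ioo (0 : ℝ) 1), aeval z (Pw w * T ^ k) := by
    intro w hwW
    have hE :=
      QhFaceMoments.euler_moment (QhFaceMoments.isWeightedHomogeneous_mul_pow hT (hPw w hwW) k)
    rw [intervalIntegral.integral_const_mul,
      intervalIntegral.integral_add (((hc1 w).const_mul _).intervalIntegrable 0 1)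
        (((hc2 w).const_mul _).intervalIntegrable 0 1),
      intervalIntegral.integral_const_mul, intervalIntegral.integral_const_mul, ← hE,
      ← Finset.prod_erase_mul W _ hwW, ← mul_assoc]
    congr 1
    push_cast
    ring
  -- sum over the weights
  rw [intervalIntegral.integral_finsetSum fun w _ => (hcs w).intervalIntegrable 0 1,
    Finset.sum_congr rfl hw, ← Finset.mul_sum]
  -- the moments add up to the vanishing moment of `(Σ_w P_w) T^k`
  have hsum : ∑ w ∈ W, ∫ z in Set.pi Set.univ (fun _ : Fin 2 => Ioo (0 : ℝ) 1),
      aeval z (Pw w * T ^ k) =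
      ∫ z in Set.pi Set.univ (fun _ : Fin 2 => Ioo (0 : ℝ) 1),
        aeval z ((∑ w ∈ W, Pw w) * T ^ k) := by
    rw [Finset.sum_mul]
    simp_rw [map_sum]
    rw [integral_finsetSum _ fun w _ => LinMoments.integrableOn_aeval (Pw w * T ^ k)]
  rw [hsum, hmom k, mul_zero]

end Summit.KontsevichZagierPeriods.InverseLandau.TateFamilyKernel.Descent

end
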